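import Summits.QuantumFields.QCD.Theses.SpectralDefectExtinction
import Literature.MathematicalPhysics.QuantumFieldTheory.QCD

/-!
# Crux `WindowExtinction` (item stmt-QuantumFields-8964), line `chessboard-cold-cells`: definitions

Proof-side vocabulary of the line `chessboard-cold-cells` for the crux
`Summit.QuantumFields.QCD.Theses.SpectralDefectExtinction.WindowExtinction` (route
SpectralDefectExtinction), single-sourced here so that the stub files
`SpectralDefectExtinctionWindowExtinctionChessboard*.lean` and the line skeleton
(`Cruxes/WindowExtinction/Lines/chessboard_cold_cells.lean`) share ONE copy:

* the two absolute constants of the line, `deepConst = 1/1600` (deep threshold `η_d/β`) and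
  `flatLevel = 1/400 = 4 · deepConst` (flatness level `θ_f/β` of a priced spatial 3-cube);
* the spatial unit 3-cube with lowest corner `y` of the four-torus `(ℤ/L)⁴` (time = direction `0`):
  `siteOf`, `spatialOffset`, `corner`;
* the mass `cubeMass` and the covariant Dirichlet energy `cubeEnergy U y v` of a colour field `v` on the
  eight corners of that cube (forward-hop convention of the tree's `wilsonDirac`, fundamental `SU(3)`), and
  the FLAT-CUBE event `CubeFlat U y θ` (Rayleigh quotient of the cube's covariant Laplacian `≤ θ`);
* the covariant Wilson (Dirichlet) energy `dirichletForm U ψ` of a colour–spinor field on the torus — by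
  Wilson positivity (`TipNoBinding.PositivityNoLeakSpread.stub_positivity`) it equals
  `Re⟨ψ, D_W(U,0,1)ψ⟩`.

* the three interface PREDICATES of the line (Prop-valued functions of a regularisation `reg`, nothing asserted):
  `SubGaussianVolume reg` (volume cap `(2L_k+1)⁴ ≤ e^{cβ_k²}` eventually, every `c > 0`), `DeepExtinctAt N_f reg η m`
  (clause (a) of the crux's EXTINCT below the deep threshold `η/β_k`, same weights and normalisation) and
  `PQFlatLD N_f reg` (phase-quenched flat-block large deviation, `e^{−7|A|}`).

No statement of the route is asserted here and no stub statement (`Prop` without parameters) is declared; these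
are abbreviations only (no named facts).  Written by the line lead (prover-line-stmt-QuantumFields-8964-c1-0) from
the planner's skeleton `Lines/chessboard-cold-cells.lean` (commit 0226fc4220bf), verbatim.
-/

noncomputable section

namespace Summit.QuantumFields.QCD.Cruxes.WindowExtinction.ChessboardColdCells

open scoped BigOperators Matrix
open Literature.MathematicalPhysics.QuantumLattice Literature.MathematicalPhysics.QuantumFieldTheory
  Literature.Probability.LatticeModels

/-- The DEEP threshold constant `η_d = 1/1600`: real modes of `D_W(U,0,1)` with `Re z < η_d/β_k` are "deep"
(priced by the chessboard line); the band `[η_d/β_k, −m_f(k))` is left to the edge stub. -/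
def deepConst : ℝ := 1 / 1600

/-- The FLATNESS level `θ_f = 1/400 = 4 η_d` at which flat spatial 3-cubes are priced (`CubeFlat U y (flatLevel/β)`);
the factor `4` absorbs Ky Fan's doubling and the IMS localisation error of the deep-extinction step. -/
def flatLevel : ℝ := 1 / 400

/-- `flatLevel = 4 · deepConst`. -/
theorem flatLevel_eq : flatLevel = 4 * deepConst := by
  norm_num [flatLevel, deepConst]

/-- `deepConst > 0`. -/
theorem deepConst_pos : 0 < deepConst := by
  norm_num [deepConst]

/-- `flatLevel > 0`. -/
theorem flatLevel_pos : 0 < flatLevel := by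
  norm_num [flatLevel]

variable {L : ℕ}

/-- The site with time coordinate `t` (direction `0`) and spatial coordinates `xs` (directions `1,2,3`). -/
def siteOf (t : ZMod L) (xs : Fin 3 → ZMod L) : TorusSite 4 L :=
  Fin.cons t xs

/-- The spatial offset `s ∈ {0,1}³` (directions `1,2,3`; time component `0`). -/
def spatialOffset (s : Fin 3 → Fin 2) : TorusSite 4 L :=
  Fin.cons 0 fun i => ((s i : ℕ) : ZMod L)

/-- Corner `y + s` of the spatial unit 3-cube with lowest corner `y`. -/
def corner (y : TorusSite 4 L) (s : Fin 3 → Fin 2) : TorusSite 4 L :=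
  y + spatialOffset s

/-- Mass `Σ_{corners} |v|²` of a colour field on the eight corners of a spatial unit 3-cube. -/
def cubeMass (v : (Fin 3 → Fin 2) → Fin 3 → ℂ) : ℝ :=
  ∑ s, ∑ a, ‖v s a‖ ^ 2

/-- Covariant Dirichlet energy `½ Σ_{12 edges (z, z+î)} |v(z) − U(z,i) v(z+î)|²` of a colour field `v` on the
corners of the spatial unit 3-cube with lowest corner `y` (edges in directions `1,2,3` = `Fin.succ i`; the
link acts in the fundamental representation, forward-hop convention of the tree's `wilsonDirac`). -/
def cubeEnergy (U : GaugeConfig 4 L SU3) (y : TorusSite 4 L) (v : (Fin 3 → Fin 2) → Fin 3 → ℂ) : ℝ :=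
  (1 / 2 : ℝ) * ∑ s : Fin 3 → Fin 2, ∑ i : Fin 3,
    if s i = 0 then
      ∑ a : Fin 3, ‖v s a - ((fundamentalRep (Fin 3) (U (corner y s, i.succ))) *ᵥ (v (Function.update s i 1))) a‖ ^ 2
    else 0

/-- **Flat cube.** The spatial unit 3-cube with lowest corner `y` is `θ`-FLAT in the gauge field `U`: its
covariant Laplacian (fundamental colour, no spin) has a Rayleigh quotient `≤ θ`, i.e. some non-zero colour
field on its corners is covariantly constant up to energy `θ·mass` — a gauge-invariant, slice-local (it sees
only the 12 spatial links of the cube), cube-symmetric event.  `θ = 0` iff the 3-cube carries a covariantly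
constant section (e.g. a pure gauge, or an `SU(2)`-valued field fixing a colour vector). -/
def CubeFlat (U : GaugeConfig 4 L SU3) (y : TorusSite 4 L) (θ : ℝ) : Prop :=
  ∃ v : (Fin 3 → Fin 2) → Fin 3 → ℂ, v ≠ 0 ∧ cubeEnergy U y v ≤ θ * cubeMass v

/-- The covariant Wilson (Dirichlet) energy of a colour–spinor field,
`½ Σ_{x,μ,a,α} |ψ(x,a,α) − Σ_b ρ(U(x,μ))_{ab} ψ(x+μ̂,b,α)|²`; for unitary links this is
`Re ⟨ψ, D_W(U,0,1) ψ⟩` (Wilson positivity, `TipNoBinding.PositivityNoLeakSpread.stub_positivity`). -/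
def dirichletForm [NeZero L] (U : GaugeConfig 4 L SU3) (ψ : QuarkIdx L → ℂ) : ℝ :=
  (1 / 2 : ℝ) * ∑ x : TorusSite 4 L, ∑ μ : Fin 4, ∑ a : Fin 3, ∑ α : Fin 4,
    ‖ψ (x, a, α) - ∑ b : Fin 3, (fundamentalRep (Fin 3) (U (x, μ))) a b * ψ (Site.shift x μ, b, α)‖ ^ 2

/-- The cube mass is non-negative. -/
theorem cubeMass_nonneg (v : (Fin 3 → Fin 2) → Fin 3 → ℂ) : 0 ≤ cubeMass v :=
  Finset.sum_nonneg fun _ _ => Finset.sum_nonneg fun _ _ => by positivity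

/-- The cube energy is non-negative. -/
theorem cubeEnergy_nonneg (U : GaugeConfig 4 L SU3) (y : TorusSite 4 L) (v : (Fin 3 → Fin 2) → Fin 3 → ℂ) :
    0 ≤ cubeEnergy U y v := by
  refine mul_nonneg (by norm_num) (Finset.sum_nonneg fun s _ => Finset.sum_nonneg fun i _ => ?_)
  split_ifs
  · exact Finset.sum_nonneg fun _ _ => by positivity
  · exact le_rfl

/-- The Dirichlet form is non-negative. -/
theorem dirichletForm_nonneg [NeZero L] (U : GaugeConfig 4 L SU3) (ψ : QuarkIdx L → ℂ) :
    0 ≤ dirichletForm U ψ :=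
  mul_nonneg (by norm_num) (Finset.sum_nonneg fun _ _ => Finset.sum_nonneg fun _ _ =>
    Finset.sum_nonneg fun _ _ => Finset.sum_nonneg fun _ _ => by positivity)

/-- Flatness is monotone in the level. -/
theorem CubeFlat.mono {U : GaugeConfig 4 L SU3} {y : TorusSite 4 L} {θ θ' : ℝ} (h : CubeFlat U y θ)
    (hθ : θ ≤ θ') : CubeFlat U y θ' := by
  obtain ⟨v, hv, hE⟩ := h
  exact ⟨v, hv, hE.trans (mul_le_mul_of_nonneg_right hθ (cubeMass_nonneg v))⟩

/-! ## Interface predicates of the line (Prop-valued functions of a regularisation; nothing is asserted) -/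

open Filter in
/-- **Sub-Gaussian volume growth** of a regularisation: `(2L_k+1)⁴ ≤ exp(c β_k²)` eventually, for every
`c > 0`.  Met by every honest witness (`a_k L_k` polynomial in `k` gives `log (2L_k+1)⁴ = O(β_k)`); violated by
the free-volume tip witnesses of `Negative.VolumeLever` — the line's built-in volume cap. -/
def SubGaussianVolume {Nf : ℕ} (reg : QCDRegularisation Nf) : Prop :=
  ∀ c : ℝ, 0 < c → ∀ᶠ k : ℕ in Filter.atTop, ((2 * reg.L k + 1 : ℕ) : ℝ) ^ 4 ≤ Real.exp (c * reg.β k ^ 2)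

open MeasureTheory in
/-- **Deep extinction at threshold `η/β_k`** for the mass tuple `m` along `reg`: the phase-quenched expected
number of REAL eigenvalues (algebraic multiplicity) of the massless `r = 1` Wilson–Dirac operator below `η/β_k`
is `≤ ε · ((2S+1)/(2L_k+1))⁴` on every torus `2S+1 ≥ 2L_k+1`, eventually in `k`, for every `ε > 0` — the
EXTINCT clause (a) of the crux restricted to the deep part of the hole (same weight, same normalisation). -/
def DeepExtinctAt (Nf : ℕ) (reg : QCDRegularisation Nf) (η : ℝ) (m : Fin Nf → ℝ) : Prop :=
  ∀ ε : ℝ, 0 < ε → ∀ᶠ k : ℕ in Filter.atTop, ∀ S : ℕ, reg.L k ≤ S →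
    (∫ U, (Multiset.countP (fun z : ℂ => z.im = 0 ∧ z.re < η / reg.β k)
          (wilsonDirac (fundamentalRep (Fin 3)) U 0 1).charpoly.roots : ℝ) *
        ∏ f : Fin Nf, ‖fermionDet (wilsonDirac (fundamentalRep (Fin 3)) U
          (reg.mcrit k + reg.a k * m f / reg.Zm k) 1)‖
        ∂(wilsonMeasure (d := 4) (L := 2 * S + 1) (fundamentalRep (Fin 3)) (reg.β k))) /
      (∫ U, ∏ f : Fin Nf, ‖fermionDet (wilsonDirac (fundamentalRep (Fin 3)) U
          (reg.mcrit k + reg.a k * m f / reg.Zm k) 1)‖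
        ∂(wilsonMeasure (d := 4) (L := 2 * S + 1) (fundamentalRep (Fin 3)) (reg.β k)))
    ≤ ε * ((2 * S + 1 : ℝ) / (2 * reg.L k + 1)) ^ 4

open MeasureTheory in
/-- **Phase-quenched flat-block large deviation along a regularisation** (interface predicate): for every positive
mass tuple, eventually in `k`, on every torus `2S+1 ≥ 2L_k+1`, under the phase-quenched weight
`e^{−β_k S} ∏_f |det D_W(U, m_crit(k) + a_k m_f/Z_k, 1)|`, every prescribed set `A` of spatial unit 3-cubes is
`(flatLevel/β_k)`-flat with probability `≤ e^{−7|A|}`. -/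
def PQFlatLD (Nf : ℕ) (reg : QCDRegularisation Nf) : Prop :=
  ∀ m : Fin Nf → ℝ, (∀ f, 0 < m f) → ∀ᶠ k : ℕ in Filter.atTop, ∀ S : ℕ, reg.L k ≤ S →
    ∀ A : Finset (TorusSite 4 (2 * S + 1)),
      (∫ U in {U | ∀ y ∈ A, CubeFlat U y (flatLevel / reg.β k)},
          ∏ f : Fin Nf, ‖fermionDet (wilsonDirac (fundamentalRep (Fin 3)) U
            (reg.mcrit k + reg.a k * m f / reg.Zm k) 1)‖
          ∂(wilsonMeasure (d := 4) (L := 2 * S + 1) (fundamentalRep (Fin 3)) (reg.β k))) /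
        (∫ U, ∏ f : Fin Nf, ‖fermionDet (wilsonDirac (fundamentalRep (Fin 3)) U
            (reg.mcrit k + reg.a k * m f / reg.Zm k) 1)‖
          ∂(wilsonMeasure (d := 4) (L := 2 * S + 1) (fundamentalRep (Fin 3)) (reg.β k)))
      ≤ Real.exp (-7 * A.card)

end Summit.QuantumFields.QCD.Cruxes.WindowExtinction.ChessboardColdCells

end
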